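import Summits.ResolutionOfSingularities.ResolutionOfSingularities.Theorems.FrobeniusLadderFInjectiveMacaulayficationGradedConeFiModelRelBlowup
import Summits.ResolutionOfSingularities.ResolutionOfSingularities.Theorems.FrobeniusLadderFInjectiveMacaulayficationE8LineGradedFiModel
import Mathlib.RingTheory.MvPolynomial.Ideal
import HarnessLib

/-!
# `E₈⁰ × 𝔸¹`: A STRONG⁺ STEP AT THE GENERIC POINT OF THE BAD LINE, at EVERY prime `p`
# (crux `FrobeniusLadder.FInjectiveMacaulayfication` stmt-ResolutionOfSingularities-15315, chain w45a; hole #3; lead seat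
# res-L1-w45a-lead-1 gen 3)

[OURS · L1 W4.5a] AI-written; AI review is weaker than expert review. NOT a statement of any manuscript; no named fact.

`R = k[X₀,…,X₃]/(f)`, `f = X₃² + X₁³ + X₂⁵` (`E₈⁰ × 𝔸¹`), `η` = the generic point of the line `V(X₁,X₂,X₃) ⊂ Spec R` (the
bad locus at `p = 2,3,5`; `(x̄₁,x̄₂,x̄₃)` is prime since `f ∈ (X₁,X₂,X₃)` and `(X₁,X₂,X₃) ⊂ k[X]` is prime). THEOREM
(`e8Line_strongPlusStep`): the `∃`-clause of the registered hole-#3 stub `stub_confinedIsoStepStrongPlus` holds for `X₁ = Spec R`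
at `η`, for EVERY prime `p`: a proper birational integral everywhere-Cohen–Macaulay `π : X₂ ⟶ Spec R`, an isomorphism exactly
off `closure {η}`, with the full crux clause at every non-closed point over `closure {η}` — the `(0,10,6,15)`-weighted blow-up
along the line (`GradedConeFiModelRelBlowup.gradedConeFiModelRel_strongPlusStep`, lead; wrapper res-L1-w45a-stub-5 p499685;
inputs `E8LineGradedFiModel`, lead p500918). This is the first kernel-checked STRONG⁺ step of GRADED type (the `E₈⁰` cone is
Newton-DEGENERATE at `p = 2,3,5`, outside the Cartier–Newton engine). Also: `(X_i : i ∈ S) ⊂ k[X]` is prime, self-contained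
(`isPrime_span_X_image`). No definitions, no named facts. [folklore]
-/

set_option linter.dupNamespace false

noncomputable section

open Literature.AlgebraicGeometry.Resolution AlgebraicGeometry MvPolynomial CategoryTheory

namespace Summit.ResolutionOfSingularities.ResolutionOfSingularities.Theorems.FInjectiveMacaulayfication.E8LineStrongPlusStep

open Summit.ResolutionOfSingularities.ResolutionOfSingularities.Theorems.FInjectiveMacaulayfication

/-! ## `(X_i : i ∈ S)` is prime in `k[X]` (any domain `k`) -/

/-- Killing the variables of `S`: `x ≡ φ_S x (mod (X_i : i ∈ S))` for `φ_S = aeval (i ↦ if i ∈ S then 0 else X i)`. [folklore] -/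
theorem sub_aeval_kill_mem {k : Type} [CommRing k] {n : ℕ} (S : Set (Fin n)) [DecidablePred (· ∈ S)]
    (x : MvPolynomial (Fin n) k) :
    x - MvPolynomial.aeval (fun i : Fin n => if i ∈ S then (0 : MvPolynomial (Fin n) k) else X i) x ∈
      Ideal.span (MvPolynomial.X '' S : Set (MvPolynomial (Fin n) k)) := by
  induction x using MvPolynomial.induction_on with
  | C a => simp
  | add p q hp hq =>
    have e : p + q - MvPolynomial.aeval (fun i : Fin n => if i ∈ S then (0 : MvPolynomial (Fin n) k) else X i) (p + q) =
        (p - MvPolynomial.aeval (fun i : Fin n => if i ∈ S then (0 : MvPolynomial (Fin n) k) else X i) p) +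
        (q - MvPolynomial.aeval (fun i : Fin n => if i ∈ S then (0 : MvPolynomial (Fin n) k) else X i) q) := by
      rw [map_add]; ring
    rw [e]
    exact Ideal.add_mem _ hp hq
  | mul_X p i hp =>
    by_cases hi : i ∈ S
    · have hXi : (X i : MvPolynomial (Fin n) k) ∈ Ideal.span (MvPolynomial.X '' S : Set (MvPolynomial (Fin n) k)) :=
        Ideal.subset_span ⟨i, hi, rfl⟩
      rw [map_mul, MvPolynomial.aeval_X, if_pos hi, mul_zero, sub_zero]
      exact Ideal.mul_mem_left _ _ hXi
    · have e : p * X i - MvPolynomial.aeval (fun i : Fin n => if i ∈ S then (0 : MvPolynomial (Fin n) k) else X i) (p * X i) =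
          (p - MvPolynomial.aeval (fun i : Fin n => if i ∈ S then (0 : MvPolynomial (Fin n) k) else X i) p) * X i := by
        rw [map_mul, MvPolynomial.aeval_X, if_neg hi]; ring
      rw [e]
      exact Ideal.mul_mem_right _ _ hp

/-- **`(X_i : i ∈ S) ⊂ k[X]` is prime** for a domain `k`: it is the kernel of the substitution killing the variables of `S`, an
endomorphism of the domain `k[X]`. [folklore] -/
theorem isPrime_span_X_image {k : Type} [CommRing k] [IsDomain k] {n : ℕ} (S : Set (Fin n)) :
    (Ideal.span (MvPolynomial.X '' S : Set (MvPolynomial (Fin n) k))).IsPrime := by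
  classical
  have hker : Ideal.span (MvPolynomial.X '' S : Set (MvPolynomial (Fin n) k)) =
      RingHom.ker (MvPolynomial.aeval (fun i : Fin n => if i ∈ S then (0 : MvPolynomial (Fin n) k) else X i)).toRingHom := by
    apply le_antisymm
    · rw [Ideal.span_le]
      rintro _ ⟨i, hi, rfl⟩
      rw [SetLike.mem_coe, RingHom.mem_ker, AlgHom.toRingHom_eq_coe, RingHom.coe_coe, MvPolynomial.aeval_X, if_pos hi]
    · intro x hx
      rw [RingHom.mem_ker, AlgHom.toRingHom_eq_coe, RingHom.coe_coe] at hx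
      have h := sub_aeval_kill_mem S x
      rwa [hx, sub_zero] at h
  rw [hker]
  exact RingHom.ker_isPrime _

/-! ## The generic point of the line on `E₈⁰ × 𝔸¹` -/

/-- `f = X₃² + X₁³ + X₂⁵` lies in `(X₁, X₂, X₃)`. [folklore] -/
theorem f_mem_span_line (k : Type) [Field k] (f : MvPolynomial (Fin 4) k) (hf : f = X 3 ^ 2 + X 1 ^ 3 + X 2 ^ 5) :
    f ∈ Ideal.span (MvPolynomial.X '' ((({1, 2, 3} : Finset (Fin 4)) : Set (Fin 4))) : Set (MvPolynomial (Fin 4) k)) := by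
  have hX : ∀ i ∈ ({1, 2, 3} : Finset (Fin 4)), (X i : MvPolynomial (Fin 4) k) ∈
      Ideal.span (MvPolynomial.X '' ((({1, 2, 3} : Finset (Fin 4)) : Set (Fin 4))) : Set (MvPolynomial (Fin 4) k)) :=
    fun i hi => Ideal.subset_span ⟨i, Finset.mem_coe.mpr hi, rfl⟩
  rw [hf]
  refine Ideal.add_mem _ (Ideal.add_mem _ ?_ ?_) ?_
  · exact Ideal.pow_mem_of_mem _ (hX 3 (by decide)) 2 two_pos
  · exact Ideal.pow_mem_of_mem _ (hX 1 (by decide)) 3 three_pos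
  · exact Ideal.pow_mem_of_mem _ (hX 2 (by decide)) 5 (by norm_num)

/-- **The line `(x̄₁, x̄₂, x̄₃) ⊂ R = k[X]/(f)` is a prime ideal** (`f ∈ (X₁,X₂,X₃)`, `(X₁,X₂,X₃)` prime in `k[X]`). [folklore] -/
theorem isPrime_span_line (k : Type) [Field k] (f : MvPolynomial (Fin 4) k) (hf : f = X 3 ^ 2 + X 1 ^ 3 + X 2 ^ 5) :
    (Ideal.span ((fun j : Fin 4 => Ideal.Quotient.mk (Ideal.span {f}) (MvPolynomial.X j)) ''
      ((({1, 2, 3} : Finset (Fin 4)) : Set (Fin 4))))).IsPrime := by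
  have heq : Ideal.span ((fun j : Fin 4 => Ideal.Quotient.mk (Ideal.span {f}) (MvPolynomial.X j)) ''
      ((({1, 2, 3} : Finset (Fin 4)) : Set (Fin 4)))) =
      (Ideal.span (MvPolynomial.X '' ((({1, 2, 3} : Finset (Fin 4)) : Set (Fin 4))) : Set (MvPolynomial (Fin 4) k))).map
        (Ideal.Quotient.mk (Ideal.span {f})) := by
    rw [Ideal.map_span, Set.image_image]
  rw [heq]
  haveI := isPrime_span_X_image (k := k) ((({1, 2, 3} : Finset (Fin 4)) : Set (Fin 4)))
  refine Ideal.map_isPrime_of_surjective Ideal.Quotient.mk_surjective ?_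
  rw [Ideal.mk_ker, Ideal.span_le, Set.singleton_subset_iff]
  exact f_mem_span_line k f hf

/-- The generic point `η` of the bad line EXISTS as a point of `Spec R` with `η.asIdeal = (x̄₁, x̄₂, x̄₃)`. [folklore] -/
theorem exists_eta (k : Type) [Field k] (f : MvPolynomial (Fin 4) k) (hf : f = X 3 ^ 2 + X 1 ^ 3 + X 2 ^ 5) :
    ∃ η : ↥(Spec (.of (MvPolynomial (Fin 4) k ⧸ Ideal.span {f}))),
      η.asIdeal = Ideal.span ((fun j : Fin 4 => Ideal.Quotient.mk (Ideal.span {f}) (MvPolynomial.X j)) ''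
        ((({1, 2, 3} : Finset (Fin 4)) : Set (Fin 4)))) :=
  ⟨⟨_, isPrime_span_line k f hf⟩, rfl⟩

/-- **`E₈⁰ × 𝔸¹`: THE STRONG⁺ STEP AT THE GENERIC POINT OF THE BAD LINE, AT EVERY PRIME `p`.** For every field `k` of
characteristic `p`, `f = X₃² + X₁³ + X₂⁵`, `R = k[X₀,…,X₃]/(f)` and `η ∈ Spec R` with `η.asIdeal = (x̄₁,x̄₂,x̄₃)`: there is a
proper birational `π : X₂ ⟶ Spec R` with `X₂` integral and everywhere Cohen–Macaulay, `π` an isomorphism exactly off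
`closure {η}`, and the full crux clause (domain, Cohen–Macaulay, Frobenius-closed parameter ideals) at every non-closed point
of `X₂` over `closure {η}` — the `∃`-clause of the registered stub `stub_confinedIsoStepStrongPlus` for this `(X₁, η)`.
[folklore] -/
theorem e8Line_strongPlusStep : ∀ (p : ℕ) [Fact p.Prime] (k : Type) [Field k] [CharP k p]
    (f : MvPolynomial (Fin 4) k), f = MvPolynomial.X 3 ^ 2 + MvPolynomial.X 1 ^ 3 + MvPolynomial.X 2 ^ 5 →
    ∀ (η : ↥(Spec (.of (MvPolynomial (Fin 4) k ⧸ Ideal.span {f})))),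
      η.asIdeal = Ideal.span ((fun j : Fin 4 => Ideal.Quotient.mk (Ideal.span {f}) (MvPolynomial.X j)) ''
        ((({1, 2, 3} : Finset (Fin 4)) : Set (Fin 4)))) →
    ∃ (X₂ : Scheme.{0}) (π : X₂ ⟶ Spec (.of (MvPolynomial (Fin 4) k ⧸ Ideal.span {f}))), IsProper π ∧
      Literature.AlgebraicGeometry.Resolution.IsBirational π ∧
      IsIntegral X₂ ∧ (∀ x : X₂, (∀ d : ℕ, ringKrullDim (X₂.presheaf.stalk x) = d → ∀ s : Fin d → X₂.presheaf.stalk x, (Ideal.span (Set.range s)).radical.IsMaximal → RingTheory.Sequence.IsWeaklyRegular (X₂.presheaf.stalk x) (List.ofFn s))) ∧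
      IsIso (π ∣_ ⟨(closure ({η} : Set ↥(Spec (.of (MvPolynomial (Fin 4) k ⧸ Ideal.span {f})))))ᶜ, isClosed_closure.isOpen_compl⟩) ∧
      ∀ x : X₂, π.base x ∈ closure ({η} : Set ↥(Spec (.of (MvPolynomial (Fin 4) k ⧸ Ideal.span {f})))) → ¬ IsClosed ({x} : Set X₂) → (IsDomain (X₂.presheaf.stalk x) ∧ ∀ d : ℕ, ringKrullDim (X₂.presheaf.stalk x) = d → ∀ s : Fin d → X₂.presheaf.stalk x, (Ideal.span (Set.range s)).radical.IsMaximal → RingTheory.Sequence.IsWeaklyRegular (X₂.presheaf.stalk x) (List.ofFn s) ∧ ∀ t : X₂.presheaf.stalk x, (∃ e : ℕ, t ^ p ^ e ∈ Ideal.span ((fun z : X₂.presheaf.stalk x => z ^ p ^ e) '' (Ideal.span (Set.range s) : Set (X₂.presheaf.stalk x)))) → t ∈ Ideal.span (Set.range s)) := by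
  intro p _ k _ _ f hf η hη
  have hwc : ∀ v ∈ ({1, 2, 3} : Finset (Fin 4)), 0 < (![0, 10, 6, 15] : Fin 4 → ℕ) v ∧
      (![0, 3, 5, 2] : Fin 4 → ℕ) v * (![0, 10, 6, 15] : Fin 4 → ℕ) v = 30 := by
    intro v hv
    simp only [Finset.mem_insert, Finset.mem_singleton] at hv
    rcases hv with rfl | rfl | rfl <;> decide
  have hw0 : ∀ v : Fin 4, v ∉ ({1, 2, 3} : Finset (Fin 4)) → (![0, 10, 6, 15] : Fin 4 → ℕ) v = 0 := by
    intro v hv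
    fin_cases v
    · rfl
    all_goals exact absurd (by decide) hv
  exact GradedConeFiModelRelBlowup.gradedConeFiModelRel_strongPlusStep p k 4 ({1, 2, 3} : Finset (Fin 4)) ⟨1, by decide⟩
    (![0, 10, 6, 15] : Fin 4 → ℕ) 30 (![0, 3, 5, 2] : Fin 4 → ℕ) (by norm_num) hwc hw0 (E8LineGradedFiModel.veroneseSplitting k)
    f 30 (hf ▸ E8LineGradedFiModel.f_isWeightedHomogeneous k) (E8LineGradedFiModel.isPrime_span_f k f hf)
    (E8LineGradedFiModel.X_ne_zero k f hf)
    (E8LineGradedFiModel.offStratum_clause_of_regular p k _ f (fun P _ hP => E8LineGradedFiModel.regular_off_line k f hf P hP))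
    η hη

end Summit.ResolutionOfSingularities.ResolutionOfSingularities.Theorems.FInjectiveMacaulayfication.E8LineStrongPlusStep

end
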